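import Mathlib
import HarnessLib
import Summits.ResolutionOfSingularities.ResolutionOfSingularities.Theorems.HomologicalConductorPersistenceCompletionAscentOneStep
import Summits.ResolutionOfSingularities.ResolutionOfSingularities.Theorems.HomologicalConductorPersistenceCompletionAscentLifting
import Summits.ResolutionOfSingularities.ResolutionOfSingularities.Theorems.HomologicalConductorPersistenceCompletionAscentPunctured
import Summits.ResolutionOfSingularities.ResolutionOfSingularities.Theorems.HomologicalConductorPersistenceCompletionAscentQuotientPair
import Summits.ResolutionOfSingularities.ResolutionOfSingularities.Theorems.HomologicalConductorPersistenceCompletionAscentSyzygyRetract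

set_option linter.dupNamespace false

/-!
# Punctured-free modules over a completion-like pair are retracts of base changes

`[OURS · L w44b · completion model, ascent half · res-type-015 gen 15]` — sixth brick towards the
discharge of the named fact `Literature.RingTheory.CohomologyAnnihilator.le_caCompletion_comap`
([BahlekehHakimianSalarianTakahashi2015, Thm. 4.5 (2)]), helper for the surface rung
`PersistenceSurface` (stmt-ResolutionOfSingularities-19970) of crux chain w44b.  NOT a statement of
the manuscript under adjudication in cell res-hironaka; commutative algebra over Mathlib and the
sibling bricks `…CompletionAscent{OneStep,Lifting,Punctured,QuotientPair,SyzygyRetract}`.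

**Theorem** (`exists_retract_baseChange_of_puncturedFree`, our Koszul-free substitute for
[BHST15, Cor. 4.4] «every `M ∈ mod₀ R̂` is a direct summand of some `N̂`»).  Let `R → S` be a flat
homomorphism of noetherian local rings with `𝔪S = 𝔫` and `R` dense in `S` (`∀ k s, ∃ r, s - r ∈ 𝔫ᵏ`;
e.g. `S = R̂`).  Then every finitely generated `S`-module `M` which is stably annihilated by a power
of every element of `𝔫` is an `S`-linear retract of `S ⊗_R N` for some finitely generated `R`-module
`N`.

Proof: induction on `dim S`.  If `dim S = 0` then `𝔫ᵏ = 0`, `R → S` is onto and `N = M`.  If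
`dim S ≥ 1`, prime avoidance gives `x ∈ 𝔪` outside the associated primes `≠ 𝔫` of `S`; a power
`w = x^{e+1}` stably annihilates `M`; the one-step lemma gives `0 → (0 :_M w) → M ⊕ ΩM → Ω(M/wM) → 0`
with `(0 :_M w)` killed by `𝔫ᵏ`; `M/wM` is punctured-free over the quotient pair `(R/(w), S/(w))`
of smaller dimension, so by induction a retract of a base change, hence so is `Ω(M/wM)`; the
lifting lemma then shows `M ⊕ ΩM ⊕ L' ≅ S ⊗_R N`.

References: A. Bahlekeh, E. Hakimian, S. Salarian, R. Takahashi, arXiv:1504.06163, Cor. 4.4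
[`BahlekehHakimianSalarianTakahashi2015`]; S. B. Iyengar, R. Takahashi, arXiv:1404.1476,
Remark 2.12 [`IyengarTakahashi2014`].
-/

noncomputable section

open CategoryTheory IsLocalRing Literature.RingTheory.CohomologyAnnihilator
open Summit.ResolutionOfSingularities.ResolutionOfSingularities.Theorems.NoZeno.SandwichCluster
open Summit.ResolutionOfSingularities.ResolutionOfSingularities.Theorems.HomologicalConductor.CompletionAscentOneStep
open Summit.ResolutionOfSingularities.ResolutionOfSingularities.Theorems.HomologicalConductor.CompletionAscentLifting
open Summit.ResolutionOfSingularities.ResolutionOfSingularities.Theorems.HomologicalConductor.CompletionAscentPunctured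
open Summit.ResolutionOfSingularities.ResolutionOfSingularities.Theorems.HomologicalConductor.CompletionAscentQuotientPair
open Summit.ResolutionOfSingularities.ResolutionOfSingularities.Theorems.HomologicalConductor.CompletionAscentSyzygyRetract
open scoped Pointwise TensorProduct

universe u

namespace Summit.ResolutionOfSingularities.ResolutionOfSingularities.Theorems.HomologicalConductor.CompletionAscentRetract

/-- Base case: if `R → S` is onto (as happens when `dim S = 0`, `𝔫ᵏ = 0`), every `S`-module `M` is
the base change of itself: `M ≅ S ⊗_R M`, in particular a retract. [folklore] -/
theorem exists_retract_baseChange_of_surjective {R S : Type u} [CommRing R] [CommRing S]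
    [Algebra R S] (hsurj : Function.Surjective (algebraMap R S)) (M : Type u) [AddCommGroup M]
    [Module S M] [Module R M] [IsScalarTower R S M] :
    ∃ (i : M →ₗ[S] S ⊗[R] M) (p : S ⊗[R] M →ₗ[S] M), p ∘ₗ i = LinearMap.id := by
  refine ⟨{ toFun := fun m => (1 : S) ⊗ₜ[R] m
            map_add' := fun m m' => TensorProduct.tmul_add _ _ _
            map_smul' := fun s m => ?_ }, LinearMap.liftBaseChange S LinearMap.id, ?_⟩
  · obtain ⟨r, rfl⟩ := hsurj s
    rw [RingHom.id_apply, algebraMap_smul, algebraMap_smul, ← TensorProduct.smul_tmul,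
      TensorProduct.smul_tmul', ]
  · refine LinearMap.ext fun m => ?_
    change LinearMap.liftBaseChange S LinearMap.id ((1 : S) ⊗ₜ[R] m) = m
    rw [LinearMap.liftBaseChange_tmul, one_smul, LinearMap.id_apply]

/-- **Punctured-free modules over a completion-like pair are retracts of base changes** (our
substitute for [BahlekehHakimianSalarianTakahashi2015, Cor. 4.4]): for a flat homomorphism `R → S`
of noetherian local rings with `𝔪S = 𝔫` and `R` dense in `S`, of Krull dimension `dim S = d`, every
finitely generated `S`-module stably annihilated by a power of every element of `𝔫` is an
`S`-retract of `S ⊗_R N` with `N` finitely generated over `R`.  Induction on `d` (see the module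
docstring). [cite: BahlekehHakimianSalarianTakahashi2015, Corollary 4.4 (substitute)] -/
theorem exists_retract_baseChange_of_puncturedFree (d : ℕ) :
    ∀ {R S : Type u} [CommRing R] [CommRing S] [Algebra R S] [IsNoetherianRing R]
      [IsNoetherianRing S] [IsLocalRing R] [IsLocalRing S] [Module.Flat R S],
      (maximalIdeal R).map (algebraMap R S) = maximalIdeal S →
      (∀ (k : ℕ) (s : S), ∃ r : R, s - algebraMap R S r ∈ maximalIdeal S ^ k) →
      ringKrullDim S = d →
      ∀ (M : ModuleCat.{u} S), Module.Finite S M →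
        (∀ y ∈ maximalIdeal S, ∃ e : ℕ, StablyAnnihilates S (y ^ e) M) →
        ∃ (N : Type u) (_ : AddCommGroup N) (_ : Module R N) (_ : Module.Finite R N)
          (i : M →ₗ[S] S ⊗[R] N) (p : S ⊗[R] N →ₗ[S] M), p ∘ₗ i = LinearMap.id := by
  induction d using Nat.strong_induction_on with
  | _ d ih => ?_
  intro R S _ _ _ _ _ _ _ _ hmap hdense hdim M hMfin hPF
  haveI := hMfin
  haveI : IsLocalHom (algebraMap R S) :=
    ((IsLocalRing.local_hom_TFAE (algebraMap R S)).out 0 2).mpr hmap.le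
  haveI : Module.FaithfullyFlat R S := Module.FaithfullyFlat.of_flat_of_isLocalHom
  by_cases hd : d = 0
  · -- base case: `𝔫ᵏ = 0`, so `R → S` is onto and `N = M`
    subst hd
    obtain ⟨k, hk⟩ := exists_maximalIdeal_pow_eq_bot_of_ringKrullDim_eq_zero (S := S)
      (by rw [hdim]; rfl)
    have hsurj : Function.Surjective (algebraMap R S) := fun s => by
      obtain ⟨r, hr⟩ := hdense k s
      rw [hk, Ideal.mem_bot, sub_eq_zero] at hr
      exact ⟨r, hr.symm⟩
    letI : Module R M := Module.compHom M (algebraMap R S)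
    haveI : IsScalarTower R S M := IsScalarTower.of_algebraMap_smul fun r m => rfl
    haveI : Module.Finite R M := finite_restrictScalars_of_pow_smul_eq_zero hdense (k := k)
      (fun x hx m => by rw [hk, Ideal.mem_bot] at hx; rw [hx, zero_smul])
    obtain ⟨i, p, hip⟩ := exists_retract_baseChange_of_surjective hsurj M
    exact ⟨M, inferInstance, inferInstance, inferInstance, i, p, hip⟩
  · -- induction step
    have hd1 : 1 ≤ d := Nat.one_le_iff_ne_zero.mpr hd
    -- choose `x ∈ 𝔪` outside the associated primes `≠ 𝔫` of `S`, and a power stably annihilating `M`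
    obtain ⟨x, hxm, hxass⟩ :=
      exists_mem_maximalIdeal_forall_notMem_associatedPrimes (R := R) (S := S) hmap
    have hy : algebraMap R S x ∈ maximalIdeal S := hmap ▸ Ideal.mem_map_of_mem _ hxm
    obtain ⟨e, he⟩ := hPF _ hy
    obtain ⟨z, hz⟩ : ∃ z : R, z = x ^ (e + 1) := ⟨_, rfl⟩
    have hzm : z ∈ maximalIdeal R := hz ▸ Ideal.pow_mem_of_mem _ hxm _ e.succ_pos
    have hwM : StablyAnnihilates S (algebraMap R S z) M := by
      rw [hz, map_pow, pow_succ']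
      exact StablyAnnihilates.mul_left _ he
    have hwn : algebraMap R S z ∈ maximalIdeal S := hmap ▸ Ideal.mem_map_of_mem _ hzm
    have hwass : ∀ P ∈ associatedPrimes S S, P ≠ maximalIdeal S → algebraMap R S z ∉ P := by
      intro P hP hne hwP
      haveI := IsAssociatedPrime.isPrime hP
      rw [hz, map_pow] at hwP
      exact hxass P hP hne (Ideal.IsPrime.mem_of_pow_mem ‹_› _ hwP)
    -- the one-step lemma
    obtain ⟨K, L, hK, hL, f, g, wfg, hS⟩ := exists_shortExact_torsionBy_prod_syzygy hwM
    obtain ⟨hfinj, hgsurj, hfg⟩ := shortExact_unpack hS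
    obtain ⟨k, hk⟩ := exists_pow_forall_smul_eq_zero_of_torsion hwass hPF
    -- the quotient pair `(R/(z), S/(z)S)`
    obtain ⟨I, hI⟩ : ∃ I : Ideal R, I = Ideal.span {z} := ⟨_, rfl⟩
    have hJ : I.map (algebraMap R S) = Ideal.span {algebraMap R S z} := by
      rw [hI, Ideal.map_span, Set.image_singleton]
    have hIm : I ≤ maximalIdeal R := by rw [hI, Ideal.span_singleton_le_iff_mem]; exact hzm
    have hJn : I.map (algebraMap R S) ≤ maximalIdeal S := by
      rw [hJ, Ideal.span_singleton_le_iff_mem]; exact hwn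
    haveI : Nontrivial (R ⧸ I) := Ideal.Quotient.nontrivial_iff.mpr
      (ne_top_of_le_ne_top (IsLocalRing.maximalIdeal.isMaximal R).ne_top hIm)
    haveI : IsLocalRing (R ⧸ I) := isLocalRing_quotient I
    haveI : Nontrivial (S ⧸ I.map (algebraMap R S)) := Ideal.Quotient.nontrivial_iff.mpr
      (ne_top_of_le_ne_top (IsLocalRing.maximalIdeal.isMaximal S).ne_top hJn)
    haveI : IsLocalRing (S ⧸ I.map (algebraMap R S)) := isLocalRing_quotient _
    haveI : Module.Flat (R ⧸ I) (S ⧸ I.map (algebraMap R S)) :=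
      Module.Flat.of_linearEquiv (Algebra.TensorProduct.quotIdealMapEquivQuotTensor S I).toLinearEquiv
    have hmap' := map_maximalIdeal_quotient (S := S) I hmap
    have hdense' := dense_quotient (S := S) I hdense
    obtain ⟨d', hd'lt, hdim'⟩ := exists_ringKrullDim_quotient_lt hwn hwass hd1 hdim hJ
    -- `M/(z)M` is punctured-free over the quotient pair: induction hypothesis
    have hMqfin : Module.Finite (S ⧸ I.map (algebraMap R S))
        (ModuleCat.of (S ⧸ I.map (algebraMap R S))
          (M ⧸ ((I.map (algebraMap R S)) • ⊤ : Submodule S M))) :=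
      Module.Finite.of_restrictScalars_finite S _ _
    have hPFq := puncturedFree_quotient (I.map (algebraMap R S)) hPF
    obtain ⟨Nq, _, _, _, iq, pq, hiq⟩ := ih d' hd'lt hmap' hdense' hdim' _ hMqfin hPFq
    -- translate: `M/(z)M` is an `S`-retract of `S ⊗_R Nq`
    letI : Module R Nq := Module.compHom Nq (Ideal.Quotient.mk I)
    haveI : IsScalarTower R (R ⧸ I) Nq := IsScalarTower.of_algebraMap_smul fun r n => rfl
    haveI : Module.Finite R Nq := Module.Finite.trans (R ⧸ I) Nq
    obtain ⟨i₁, p₁, hip₁⟩ := exists_retract_of_retract_quotientPair I iq pq hiq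
    have hJw : ((I.map (algebraMap R S)) • ⊤ : Submodule S M) =
        algebraMap R S z • (⊤ : Submodule S M) := by
      rw [hJ, Submodule.ideal_span_singleton_smul]
    let eq : (M ⧸ ((I.map (algebraMap R S)) • ⊤ : Submodule S M)) ≃ₗ[S]
        (M ⧸ (algebraMap R S z • (⊤ : Submodule S M))) := Submodule.quotEquivOfEq _ _ hJw
    have hip₁' : ∀ v, p₁ (i₁ v) = v := fun v => LinearMap.congr_fun hip₁ v
    have hret : ModuleCat.ofHom (X := ModuleCat.of S (M ⧸ (algebraMap R S z • (⊤ : Submodule S M))))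
        (Y := ModuleCat.of S (S ⊗[R] Nq)) (i₁ ∘ₗ eq.symm.toLinearMap) ≫
        ModuleCat.ofHom (X := ModuleCat.of S (S ⊗[R] Nq))
        (Y := ModuleCat.of S (M ⧸ (algebraMap R S z • (⊤ : Submodule S M)))) (eq.toLinearMap ∘ₗ p₁) =
        𝟙 _ := by
      apply ModuleCat.hom_ext
      refine LinearMap.ext fun v => ?_
      change eq (p₁ (i₁ (eq.symm v))) = v
      rw [hip₁', LinearEquiv.apply_symm_apply]
    -- `L = Ω(M/zM)` is a retract of `S ⊗_R N'`
    obtain ⟨N', _, _, _, iL, pL, hipL⟩ := exists_retract_baseChange_syzygy_local _ _ hret 1 hL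
    have hipL' : ∀ l, pL (iL l) = l := fun l => LinearMap.congr_fun hipL l
    obtain ⟨εL⟩ := exists_iso_prod_of_retract (ModuleCat.ofHom iL) (ModuleCat.ofHom pL)
      (ModuleCat.hom_ext (LinearMap.ext fun l => hipL' l))
    -- `A = (0 :_M z)` is killed by `𝔫ᵏ`: finite-length transfer
    let A := Submodule.torsionBy S M (algebraMap R S z)
    letI : Module R A := Module.compHom A (algebraMap R S)
    haveI : IsScalarTower R S A := IsScalarTower.of_algebraMap_smul fun r a => rfl
    have hAn : ∀ xx ∈ maximalIdeal S ^ k, ∀ a : A, xx • a = 0 := fun xx hxx a =>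
      Subtype.ext (hk xx hxx (a : M) ((Submodule.mem_torsionBy_iff _ (a : M)).mp a.2))
    haveI : IsNoetherian S M := isNoetherian_of_isNoetherianRing_of_finite S M
    haveI : Module.Finite S A := Module.IsNoetherian.finite S A
    haveI : Module.Finite R A := finite_restrictScalars_of_pow_smul_eq_zero hdense hAn
    have hAm : ∀ xx ∈ maximalIdeal R ^ k, ∀ a : A, xx • a = 0 := fun xx hxx a => by
      have h1 : algebraMap R S xx ∈ maximalIdeal S ^ k := by
        rw [← hmap, ← Ideal.map_pow]; exact Ideal.mem_map_of_mem _ hxx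
      exact hAn _ h1 a
    have hbij := mk_one_bijective_of_pow_smul_eq_zero hmap hdense hAm
    let eA : S ⊗[R] A →ₗ[S] A := LinearMap.liftBaseChange S LinearMap.id
    have heA : ∀ a : A, eA ((1 : S) ⊗ₜ[R] a) = a := fun a => by
      change LinearMap.liftBaseChange S LinearMap.id ((1 : S) ⊗ₜ[R] a) = a
      rw [LinearMap.liftBaseChange_tmul, one_smul, LinearMap.id_apply]
    have heAinj : Function.Injective eA := by
      intro u v huv
      obtain ⟨a, rfl⟩ := hbij.2 u
      obtain ⟨b, rfl⟩ := hbij.2 v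
      change eA ((1 : S) ⊗ₜ[R] a) = eA ((1 : S) ⊗ₜ[R] b) at huv
      rw [heA, heA] at huv
      rw [huv]
    -- the extension `0 → S ⊗ A → (M ⊕ K) ⊕ L' → S ⊗ N' → 0`
    let L' := LinearMap.ker pL
    let f₂ : S ⊗[R] A →ₗ[S] (M × K) × L' := LinearMap.inl S (M × K) L' ∘ₗ f.hom ∘ₗ eA
    let g₂ : (M × K) × L' →ₗ[S] S ⊗[R] N' := εL.inv.hom ∘ₗ g.hom.prodMap LinearMap.id
    have hf₂ : ∀ u, f₂ u = (f.hom (eA u), 0) := fun u => rfl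
    have hg₂ : ∀ b : (M × K) × L', g₂ b = εL.inv.hom (g.hom b.1, b.2) := fun b => rfl
    have hεinj : Function.Injective εL.inv.hom := fun a b hab => by
      have := congrArg εL.hom.hom hab
      rwa [← ModuleCat.comp_apply, ← ModuleCat.comp_apply, εL.inv_hom_id] at this
    have hεsurj : Function.Surjective εL.inv.hom := fun v =>
      ⟨εL.hom.hom v, by rw [← ModuleCat.comp_apply, εL.hom_inv_id]; rfl⟩
    have hf₂inj : Function.Injective f₂ := fun u v huv => by
      rw [hf₂, hf₂, Prod.mk.injEq] at huv
      exact heAinj (hfinj huv.1)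
    have hg₂surj : Function.Surjective g₂ := by
      intro v
      obtain ⟨⟨l, l'⟩, rfl⟩ := hεsurj v
      obtain ⟨mk, rfl⟩ := hgsurj l
      exact ⟨(mk, l'), rfl⟩
    have hfg₂ : Function.Exact f₂ g₂ := by
      intro b
      constructor
      · intro hb
        rw [hg₂] at hb
        have h0 : (g.hom b.1, b.2) = 0 := hεinj (by rw [hb, map_zero])
        rw [Prod.mk_eq_zero] at h0
        obtain ⟨a, ha⟩ := (hfg _).1 h0.1
        obtain ⟨u, hu⟩ : ∃ u, eA u = a := ⟨(1 : S) ⊗ₜ[R] a, heA a⟩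
        refine ⟨u, ?_⟩
        rw [hf₂, hu]
        exact Prod.ext ha h0.2.symm
      · rintro ⟨u, rfl⟩
        rw [hg₂, hf₂]
        change εL.inv.hom (g.hom (f.hom (eA u)), 0) = 0
        rw [hfg.apply_apply_eq_zero, Prod.mk_zero_zero, map_zero]
    obtain ⟨NB, _, _, _, ⟨eB⟩⟩ :=
      exists_linearEquiv_baseChange_of_extension (A₀ := A) (N := N') (B := (M × K) × L') hbij f₂ g₂
        hf₂inj hg₂surj hfg₂
    refine ⟨NB, inferInstance, inferInstance, inferInstance,
      eB.toLinearMap ∘ₗ (LinearMap.inl S (M × K) L' ∘ₗ LinearMap.inl S M K),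
      (LinearMap.fst S M K ∘ₗ LinearMap.fst S (M × K) L') ∘ₗ eB.symm.toLinearMap,
      LinearMap.ext fun m => ?_⟩
    change ((eB.symm (eB ((m, 0), 0))).1).1 = m
    rw [LinearEquiv.symm_apply_apply]

end Summit.ResolutionOfSingularities.ResolutionOfSingularities.Theorems.HomologicalConductor.CompletionAscentRetract

end
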